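import Summits.ResolutionOfSingularities.ResolutionOfSingularities.Theorems.EquisingularLiftEquisingularLiftBlowupModelSubmaxLinN
import Summits.ResolutionOfSingularities.ResolutionOfSingularities.Theorems.EquisingularLiftEquisingularLiftNatSubmaxLineLinSubst
import HarnessLib

/-!
# [OURS · EL♮] THE ALL-DIMENSION SUBMAXIMAL FAMILY — side conditions from PRIMALITY and ANY LINEAR COORDINATES: EL♮ and regular blow-up models
# for every PRIME `F = Σ_{j≤r} x_j·A_j(x_{r+1},x_{r+2}) + C(x_{r+1},x_{r+2})` over `K = K̄`, and for every `(H, ι)` projectively equivalent to such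
# a hypersurface (crux `Theses.EquisingularLift.EquisingularLiftNat`, stmt-ResolutionOfSingularities-20038; blow-up models: stmt-…-15660)

[OURS · leafhand-res-equisingularlift-7 g0, 2026-08-31; cell `pub/decomp-res`] AI-produced, weaker than expert review; NOT a statement of any
manuscript; nothing here proves resolution of singularities in positive characteristic.  DEF-FREE helper; no `sorry`; standard axioms; ZERO named
hypotheses.  The `r = 1` versions are `SubmaxLine.elNatAt_of_prime` / `elNatAt_of_linSubst_submaxLine` (p822337 / p822516).

* `no_common_zero_of_primeN`, `exists_ne_zero_of_primeN` — for `F` prime of degree `d + 2 ≥ 2` over `K̄`: `(A_j)_j, C` have no common zero on `ℙ¹`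
  (a common zero gives a common linear factor `ℓ(x_{r+1},x_{r+2})` of `F`, ✓ `SubmaxLine.exists_linear_dvd` / `not_prime_of_linear_dvd`) and some
  `A_j ≠ 0` (else `F = C(x_{r+1},x_{r+2})` has a zero, ✓ `SubmaxLine.exists_eval_eq_zero`);
* ★★ `elNatAt_submaxLinN_of_prime`, ★★ `blowupModel_of_range_eq_submaxLinN_of_prime` (binder shape of crux `EquisingularLift`; the
  `hypersurface F` form is `blowupModel_submaxLinN` with the two side conditions supplied by the lemmas above) — hypotheses: the shape and `Prime F` only;
* ★★ `elNatAt_of_linSubst_submaxLinN` — `ELNatAt p k (r+2) H ι` for every closed immersion `ι` with `range ι = V₊(F)`, `F` prime, and `σ_{τ'} F` of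
  the shape for some invertible linear substitution (✓ `QuadricELNat.elNatAt_of_elNatAt_linSubst`, p820173): **every integral hypersurface of
  `ℙⁿ_k̄` (`n ≥ 2`) of degree `e` having a codimension-2 linear subspace of multiplicity `e − 1` satisfies EL♮, every `p`.**
-/

set_option linter.dupNamespace false -- mandated namespace `Summit.<Summit>.<Problem>` of this single-conjunct summit

noncomputable section

open CategoryTheory CategoryTheory.Limits AlgebraicGeometry TopologicalSpace
open MvPolynomial
open Literature.AlgebraicGeometry.Resolution
open Literature.AlgebraicGeometry.Motives Literature.AlgebraicGeometry.Motives.SmoothHypersurface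

namespace Summit.ResolutionOfSingularities.ResolutionOfSingularities.Cruxes.EquisingularLiftNat.Sections

namespace SubmaxLinN

variable (K : Type) [Field K] {r d : ℕ} (A : Fin (r + 1) → MvPolynomial (Fin 2) K) (C : MvPolynomial (Fin 2) K)
  (hA : ∀ j, (A j).IsHomogeneous (d + 1)) (hC : C.IsHomogeneous (d + 2)) (F : MvPolynomial (Fin (r + 1 + 1 + 1)) K)
  (hF : F = ∑ j : Fin (r + 1), (X (j.castSucc.castSucc) : MvPolynomial (Fin (r + 1 + 1 + 1)) K) *
      rename (fun b : Fin 2 => (⟨r + 1 + b, by omega⟩ : Fin (r + 1 + 1 + 1))) (A j) +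
    rename (fun b : Fin 2 => (⟨r + 1 + b, by omega⟩ : Fin (r + 1 + 1 + 1))) C)

include hA hC hF in
/-- ★ **`F` prime ⟹ `(A_j)_j, C` have no common zero on `ℙ¹`** (`K` infinite): a common zero yields a common non-zero linear factor
`ℓ(x_{r+1}, x_{r+2})` of all `A_j` and `C`, hence of `F`, of degree `d + 2 ≥ 2`. [folklore] -/
theorem no_common_zero_of_primeN [Infinite K] (hprime : Prime F) :
    ∀ v : Fin 2 → K, v ≠ 0 → ¬ ((∀ j, MvPolynomial.eval v (A j) = 0) ∧ MvPolynomial.eval v C = 0) := by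
  rintro v hv ⟨ha, hc⟩
  obtain ⟨ℓ, hℓ, hℓ0, hℓdvd⟩ := SubmaxLine.exists_linear_dvd K v hv
  have hι : Function.Injective (fun b : Fin 2 => (⟨r + 1 + b, by omega⟩ : Fin (r + 1 + 1 + 1))) := by
    intro b b' h
    have := congrArg Fin.val h
    simp at this
    exact Fin.ext this
  have hFh : F.IsHomogeneous (d + 2) := by
    rw [hF]
    exact isHomogeneous_shape K A C hA hC
  refine SubmaxLine.not_prime_of_linear_dvd K F (rename (fun b : Fin 2 => (⟨r + 1 + b, by omega⟩ : Fin (r + 1 + 1 + 1))) ℓ) hFh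
    (by omega) hℓ.rename_isHomogeneous (fun h0 => hℓ0 (rename_injective _ hι (by rw [h0, map_zero]))) ?_ hprime
  rw [hF]
  exact dvd_add (Finset.dvd_sum fun j _ => dvd_mul_of_dvd_right (map_dvd _ (hℓdvd (A j) _ (hA j) (ha j))) _)
    (map_dvd _ (hℓdvd C _ hC hc))

include hA hC hF in
/-- ★ **`F` prime ⟹ some `A_j ≠ 0`** (`K = K̄`): otherwise `F = C(x_{r+1}, x_{r+2})` and `C` has a zero on `ℙ¹`. [folklore] -/
theorem exists_ne_zero_of_primeN [IsAlgClosed K] (hprime : Prime F) : ∃ j, A j ≠ 0 := by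
  by_contra h
  push Not at h
  obtain ⟨v, hv, hvC⟩ := SubmaxLine.exists_eval_eq_zero K C hC (by omega)
  exact no_common_zero_of_primeN K A C hA hC F hF hprime v hv ⟨fun j => by rw [h j, map_zero], hvC⟩

include hA hC hF in
/-- ★★ **EL♮, EVERY DIMENSION, FOR EVERY PRIME `F = Σ_{j≤r} x_j·A_j(x_{r+1},x_{r+2}) + C(x_{r+1},x_{r+2})`** (`K = K̄` of characteristic `p`,
ANY `p`, ANY `r`): `ELNatAt p K (r+2) V₊(F) ι`. [OURS · lh7] [cite: Hartshorne1977, I Ex. 5.12] -/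
theorem elNatAt_submaxLinN_of_prime (p : ℕ) (hp : p.Prime) [CharP K p] [IsAlgClosed K] (hprime : Prime F) :
    Theorems.EquisingularLift.ELNatAt p K (r + 1 + 1) (hypersurface F).left (hypersurfaceι F).left :=
  elNatAt_submaxLinN K A C hA hC F hF (by rw [hF]; exact isHomogeneous_shape K A C hA hC) p hp hprime
    (exists_ne_zero_of_primeN K A C hA hC F hF hprime) (no_common_zero_of_primeN K A C hA hC F hF hprime)

/-- ★★ **EL♮ IN ANY LINEAR COORDINATES, EVERY DIMENSION**: for mutually inverse linear substitutions `τ, τ'` of `k[x₀, …, x_{r+2}]`, a closed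
immersion `ι : H ⟶ ℙ^{r+2}_k` with `range ι = V₊(F)`, `F` prime with `σ_{τ'} F = Σ_{j≤r} x_j·A_j(x_{r+1},x_{r+2}) + C(x_{r+1},x_{r+2})`
(`A_j` binary forms of degree `d + 1`, `C` of degree `d + 2`): `ELNatAt p k (r+2) H ι`, ANY `p` — i.e. **every integral hypersurface of degree `e`
in `ℙⁿ_k̄`, `n ≥ 2`, with a codimension-2 linear subspace of multiplicity `e − 1` satisfies EL♮** (✓ `QuadricELNat.elNatAt_of_elNatAt_linSubst`).
[OURS · lh7] [cite: Hartshorne1977, I Ex. 5.12] -/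
theorem elNatAt_of_linSubst_submaxLinN {k : Type} [Field k] (p : ℕ) (hp : p.Prime) [CharP k p] [IsAlgClosed k] {r d : ℕ}
    (τ τ' : Fin (r + 1 + 1 + 1) → MvPolynomial (Fin (r + 1 + 1 + 1)) k)
    (hτ : ∀ i, (τ i).IsHomogeneous 1) (hτ' : ∀ i, (τ' i).IsHomogeneous 1)
    (hinv : ∀ i, aeval τ (τ' i) = X i) (hinv' : ∀ i, aeval τ' (τ i) = X i)
    (A : Fin (r + 1) → MvPolynomial (Fin 2) k) (C : MvPolynomial (Fin 2) k)
    (hA : ∀ j, (A j).IsHomogeneous (d + 1)) (hC : C.IsHomogeneous (d + 2))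
    {H : Scheme.{0}} (ι : H ⟶ (projectiveSpace (r + 1 + 1) k).left) [IsClosedImmersion ι] (F : MvPolynomial (Fin (r + 1 + 1 + 1)) k)
    (hprime : Prime F)
    (hshape : aeval τ' F = ∑ j : Fin (r + 1), (X (j.castSucc.castSucc) : MvPolynomial (Fin (r + 1 + 1 + 1)) k) *
        rename (fun b : Fin 2 => (⟨r + 1 + b, by omega⟩ : Fin (r + 1 + 1 + 1))) (A j) +
      rename (fun b : Fin 2 => (⟨r + 1 + b, by omega⟩ : Fin (r + 1 + 1 + 1))) C)
    (hrange : letI := MvPolynomial.gradedAlgebra (σ := Fin (r + 1 + 1 + 1)) (R := k)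
      Set.range ι = {x : Proj (homogeneousSubmodule (Fin (r + 1 + 1 + 1)) k) | F ∈ x.asHomogeneousIdeal}) :
    Theorems.EquisingularLift.ELNatAt p k (r + 1 + 1) H ι :=
  QuadricELNat.elNatAt_of_elNatAt_linSubst τ τ' hτ hτ' hinv hinv' p ι F hrange
    (elNatAt_submaxLinN_of_prime k A C hA hC (aeval τ' F) hshape p hp (SubmaxLine.prime_aeval_of_prime τ τ' hinv hinv' hprime))

end SubmaxLinN

end Summit.ResolutionOfSingularities.ResolutionOfSingularities.Cruxes.EquisingularLiftNat.Sections

namespace Summit.ResolutionOfSingularities.ResolutionOfSingularities.Cruxes.EquisingularLift.StrataSplit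

open Summit.ResolutionOfSingularities.ResolutionOfSingularities.Cruxes.EquisingularLiftNat.Sections

/-- ★★ **Regular blow-up model in the binder shape of crux `EquisingularLift`, every dimension, for every PRIME `F` of the shape**
`Σ_{j≤r} x_j·A_j(x_{r+1},x_{r+2}) + C(x_{r+1},x_{r+2})` (`k = k̄`): `ι : H ↪ ℙ^{r+2}_k` a closed immersion, `H` integral, `range ι = V₊(F)` ⟹
`∃ 𝔞 ≠ ⊥` on `H` with all blow-ups regular. [OURS · lh7] [cite: Hartshorne1977, II Cor. 5.16] -/
theorem blowupModel_of_range_eq_submaxLinN_of_prime {k : Type} [Field k] [IsAlgClosed k] {r d : ℕ} {H : Scheme.{0}}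
    (ι : H ⟶ (projectiveSpace (r + 1 + 1) k).left) [IsClosedImmersion ι] [IsIntegral H]
    (A : Fin (r + 1) → MvPolynomial (Fin 2) k) (C : MvPolynomial (Fin 2) k)
    (hA : ∀ j, (A j).IsHomogeneous (d + 1)) (hC : C.IsHomogeneous (d + 2)) (F : MvPolynomial (Fin (r + 1 + 1 + 1)) k)
    (hF : F = ∑ j : Fin (r + 1), (X (j.castSucc.castSucc) : MvPolynomial (Fin (r + 1 + 1 + 1)) k) *
        rename (fun b : Fin 2 => (⟨r + 1 + b, by omega⟩ : Fin (r + 1 + 1 + 1))) (A j) +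
      rename (fun b : Fin 2 => (⟨r + 1 + b, by omega⟩ : Fin (r + 1 + 1 + 1))) C)
    (hprime : Prime F)
    (hrange : letI := MvPolynomial.gradedAlgebra (σ := Fin (r + 1 + 1 + 1)) (R := k)
      Set.range ι = {x : Proj (homogeneousSubmodule (Fin (r + 1 + 1 + 1)) k) | F ∈ x.asHomogeneousIdeal}) :
    ∃ 𝔞 : H.IdealSheafData, 𝔞 ≠ ⊥ ∧ ∀ (Z : Scheme.{0}) (π : Z ⟶ H), IsBlowup π 𝔞 → Scheme.IsRegular Z :=
  blowupModel_of_range_eq_submaxLinN ι A C hA hC F hF hprime (SubmaxLinN.exists_ne_zero_of_primeN k A C hA hC F hF hprime)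
    (SubmaxLinN.no_common_zero_of_primeN k A C hA hC F hF hprime) hrange

end Summit.ResolutionOfSingularities.ResolutionOfSingularities.Cruxes.EquisingularLift.StrataSplit

end
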